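import Literature.MathematicalPhysics.QuantumFieldTheory.Balaban1983to89.B9B8KnitBondCLettersAtParsReg335
import Literature.MathematicalPhysics.QuantumFieldTheory.Balaban1983to89.B9B8KnitBondWordDiffAtPars

/-!
# `Balaban1983to89.B9B8KnitBondWordDiffAtParsReg335` — T. Bałaban, *Propagators for lattice gauge theories in a background field*, Commun. Math. Phys. **99**
# (1985) 389–434 [Balaban1985BackgroundPropagators], (3.25)–(3.26) pp. 394–395, (3.49) p. 399: THE BLOCK MAJORANT OF `D_U P_S D*_U − D_U P_K D*_U`
# (`P = G′Q′*(Q′G′²Q′*)⁻¹Q′G′`) AT `(parSymY, parKnitY)` FOR EVERY MEMBER OF THE LOCAL CLASS (3.35) p. 396 — t2s-1's `B9B8KnitBondWordDiffAtPars` and 5a §3 ∕ §5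
# (`B9B8KnitBondCLettersAtPars`) WITHOUT [5]'s global (52), every knit-side letter supplied by files 1–4 of this chain (the level-weighted `E`)

statement-level skeleton of published theorems with citation tags; proofs where landed; nothing here is a claim about the Yang–Mills mass gap

THE PRINT (page owner r06).  (3.25)–(3.26) pp. 394–395, (3.27) p. 395, (3.49) p. 399 (the `DPD*` entry), (3.19) p. 393 vs (3.40) p. 397 (print has ONE transporter
convention; the junction `parSymY ↔ parKnitY` is a formalisation artefact), Thm 3.1 (3.42) p. 397, Thm 3.2 (3.48) p. 398, (3.35) p. 396, (3.90) pp. 409–410, (3.95)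
p. 411, (3.106) p. 414; [4] Prop. 2.2 (2.50)–(2.55) p. 232, Lemma 2.1 (2.60)–(2.61) p. 234, (2.66)–(2.67) p. 234; [5] (17)–(20) pp. 20–21, (44) p. 24, (52)–(53) pp. 26–27.

WHY THIS FILE (cell `pub-ymgap`, node N06, seat `dag-n06-j` gen 36; file 5 of the chain «Thm 3.3's block at `parKnitY` on (3.35)»).  `Δ_a(U; parKnitY) − Δ_a(U; parSymY) =
D_U(R_K − R_S)D*_U = −(D_UP_KD*_U − D_UP_SD*_U)` ((3.26); `B9B8KnitBondResolvent.deltaAY_sub_deltaAY_eq_DPDsY_sub`).  p38's 2b `hasMajorant_conj_DPDsY_sub` prices the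
difference of the two `DPD*` words from thirteen member-level letter majorants; t2s-1's 2c discharged them at `(parSymY, parKnitY)` under the GLOBAL (52).  THIS FILE
is 2c ON (3.35): the `G′`-sector and the `Q′`-sector from file 3 (`B9B8KnitBondGpQLettersAtParsReg335`), the `C`-sector from file 4 (`B9B8KnitLetterXDiffCinvReg335`) through
5a §3 ∕ §5 re-run in `B9B8KnitBondCLettersAtParsReg335`, all on n06-l's two local lemmas and the level-weighted `E`; the binder list is t2s-1's with THREE honest changes: the (52) data
`(hGa, hU, hα, h52)` become `U ∈ (bg9KP … G i).Reg335 c₀ α₀` + `K_pl(Mα₀)L⁴ < α₀′` (+ `|u| ≤ 1` on `G`, a section `ιB` of `β`), the scale-transfer constant carries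
`1 ≤ C`, and the entry differences take the transfer of `ℓ⁻¹` (instead of `ℓ`, `ℓ²`) at `(δ_b, α_b, Λ)`, `Λ ≥ 1`.  The conclusion and its constant `κ_J` are
t2s-1's VERBATIM.

WHAT IS PROVED (sorry-free; 0 `def`).  ★★★ `hasMajorant_conj_DPDsY_sub_pars_reg335` — `conj b((D_UP_SD*_U − D_UP_KD*_U)^ℝ) ≺ κ_J·(ℓ(a)²)⁻¹·e^{−ρd(a,a′)}` over `(toB6 (geo9K i) Rr Hp, ιB∘blkV1)` for
  every member of (3.35), `κ_J` t2s-1's named polynomial (each summand carries `θ_X, θ_Y, θ_Q` or `θ_C = O(α₀′)`).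
HONEST SCOPE.  Bookkeeping over landed results (2b, 5a §4, files 1–4); the `parSymY`-side data (M5.5's `A, A₁, A₂`, M5.6's `K`), the geometry facts and the windows are
HYPOTHESES; helper, count-neutral; N06 NOT discharged; nothing continuum ∕ OS ∕ mass gap ∕ Clay — the Yang–Mills mass gap is NOT proved here.  No `sorry`, no `axiom`,
no `instance`, no `notation`, no `def`.  NEW file.
RELATED, NOT DUPLICATED (searched 2026-08-30: `rg -l -w "WordDiffAtParsReg335|cLetters_pars_of_data_reg335|DPDsY_sub_pars_reg335"` over `lean/Literature` = ∅): t2s-1's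
`B9B8KnitBondWordDiffAtPars` ∕ `B9B8KnitBondCLettersAtPars` (the (52) originals; `kGeo_eta_pow_four`, `hasMajorant_conj_XinvY_sub_pars_of_majorants`,
`hasMajorantHom_rightEntry_parSymY`, the `parSymY`-side `Q′`-letters USED BY NAME), p38's 2b `B9B8KnitBondWordDiff` (the engine, USED BY NAME).
-/

noncomputable section

namespace Literature.MathematicalPhysics.QuantumFieldTheory.Balaban1983to89.B9B8KnitBondWordDiffAtParsReg335

open Node00 B9Thm311DeltaPrimePos B9Thm311ReadingCoords
open B6Geom246MultiLevelBox (blkOf)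
open B6KLevelCensusIndexV1 (KIdx kGeo)
open B6GlobalChartV1 (blkV1)
open B6Ineq2142KLevelV1 (β)
open B6RandomWalk (HasMajorant Triangle254 Ineq261 Ineq263 hasMajorant_mono c1_nonneg)
open B6RandomWalkHom (HasMajorantHom hasMajorantHom_mono)
open B9Thm34Ext (toB6)
open B9GeoNormsKLevelV1 (geo9K geo9K_dist_nonneg)
open B9GeoLemma21KLevelV1 (geo9K_len_pos)
open B9Ineq347 (ScaleTransfer)
open B9Ineq349Hom (hasMajorantHom_rate_mono)
open B9Eq352DivFormLetters (conj)
open B9Eq352GradLetters (diffLetter)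
open B9Eq376POneLetters (conjHom gradLin divLin)
open B9Eq3104CutoffCommutators (DPDsY)
open B9Ineq349SiteComposite (etaS_pos)
open B9Cor36GpCoverBindersUnitary (etaS_eq_kGeo_eta_of_cf)
open B9B8KnitBondWordDiff (hasMajorant_conj_DPDsY_sub)
open B9B8KnitBondGpLettersAtPars (hasMajorantHom_rightEntry_parSymY)
open B9B8KnitBondCLettersAtPars (hasMajorantHom_conjHom_QpY_parSymY hasMajorantHom_conjHom_QpsY_parSymY hasMajorant_conj_XinvY_sub_pars_of_majorants)
open B9B8KnitBondWordDiffAtPars (kGeo_eta_pow_four)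
open B9B8KnitLetterXDiffMajorant (rate_le hasMajorant_rate_mono)
open B9B8KnitLetterTransferReg335 (hasMajorant_conj_smul_sub_print_reg335 hasMajorant_conj_GpY_parKnitY_of_parSymY_reg335)
open B9B8KnitBondGpQLettersAtParsReg335 (hasMajorantHom_conjHom_QpY_parKnitY_reg335 hasMajorantHom_conjHom_QpsY_parKnitY_reg335
  hasMajorantHom_conjHom_QpY_sub_pars_reg335 hasMajorantHom_conjHom_QpsY_sub_pars_reg335 hasMajorantHom_leftEntry_parKnitY_reg335
  hasMajorantHom_leftEntry_sym_sub_knit_reg335 hasMajorantHom_rightEntry_sym_sub_knit_reg335)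
open B9B8KnitBondCLettersAtParsReg335 (cLetters_pars_of_data_reg335)
open B7Prop2Explicit (C0 c2' unitaryUnits)
open B9B8AveragingJunction (parKnitY)
open B9Eq3124HZKnitPairReg335Y (parKnitY_mem_unitary_of_reg335P)
open B9BackgroundsKLevelV1P (bg9KP mem_of_reg335P)
open B9C2FormBoxRegimeY (Kpl)
open scoped Matrix Matrix.Norms.L2Operator

variable {d ℓ : ℕ} {hd : 1 ≤ d + 1} {hL : Odd (ℓ + 1) ∧ 1 < ℓ + 1} {b₀ b₁ : ℝ}
variable (i : KIdx d ℓ hd hL b₀ b₁) {N : ℕ} {G : Subgroup (Matrix (Fin N) (Fin N) ℂ)ˣ}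
variable {ι : Type} [Fintype ι] [DecidableEq ι] (b : Module.Basis ι ℝ (Matrix (Fin N) (Fin N) ℂ))
variable [Fintype (geo9K i).Site] [DecidableEq (geo9K i).Site] {Rr : ℝ} {Hp : Prop} (ιB : BlkY i → IBondY i)

/-! ## ★★★ The block majorant of `D_UP_SD*_U − D_UP_KD*_U` on (3.35) -/

/-- ★★★ **[B9] (3.26) ∕ (3.49) AT THE TWO TABLES `(parSymY, parKnitY)` FOR EVERY MEMBER OF THE LOCAL CLASS (3.35): THE BLOCK MAJORANT OF `D_UP_SD*_U − D_UP_KD*_U` FROM def-Y's-SIDE DATA.**  For `G ≤ U(N)`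
averaging-closed, `N ≥ 1`, a `G`-valued `U` on [B7]'s class (52) (`pdev (liftCfg U) < α₀′(L^k)⁻²`, `0 < α₀′`, `C₀α₀′ ≤ ⅓`, `2α₀′ ≤ c₂′`), print's units `c_f = L^k`, a real
basis `b` with coordinate bound `M₂`, a block labelling `ιB`; DISPLAYED at the rate `δ₀`: M5.5's (3.42)₁ majorant `Aℓ²e^{−δ₀d}` of `conj b(η²G′(U; parSymY))`, its `d + 1`
LEFT products `conj b(∂_{U,μ})·conj b(η²G′_S) ≺ A₁ℓe^{−δ₀d}` and RIGHT products `conj b(η²G′_S)·conj b(∂*_{U,ν}) ≺ A₂ℓe^{−δ₀d}` (J-B file 10's shapes), M5.6's (3.48)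
majorant `K(ℓ⁴)⁻¹e^{−δ₀d}` of `conj b(η⁻⁴X(U; parSymY)⁻¹)`; the geometry ((2.54), `d(y,y) = 0`; file 9's (2.61)∕(2.63) at `(δ₀, α_g)`; the entry differences' (2.61) at
`(δ_b, β_b)` with the transfers of `ℓ`, `ℓ²` at `(δ_b, α_b, Λ)`; 5a's ladder `δ ≤ (1−α_g)δ₀`, `δ₁, δ₂, δ₃` with its transfers and (2.61)'s, the difference's (2.61) at
`(δ₅, β₅)` with the transfer of `ℓ⁻⁴` at `(δ₅, α₅, Λ₄ ≥ 1)`; 2b's (2.61) at `(δ_B, β_B)` with the transfers of `ℓ`, `ℓ⁻⁴` at `(δ_B, α_B, Λ_B ≥ 1)`), the budgets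
`δ_c + (α_b+β_b)δ_b ≤ (1−α_g)δ₀`, `δ_c + 2(α₅+β₅)δ₅ ≤ (1−α)δ₃`, `ρ + (2α_B+β_B)δ_B ≤ δ_c`, and the windows `θ_EAc₁(d_g,δ₀,α_g) < 1` (file 9),
`θ_FKC₄c₁c₁ < 1` (23c).  THEN `conj b((D_UP_SD*_U − D_UP_KD*_U)^ℝ) ≺ κ_J·(ℓ(a)²)⁻¹·e^{−ρd(a,a′)}` over `(toB6 (geo9K i) Rr Hp, ιB∘blkV1)` with the constant `κ_J` of the
header (named binders).  [cite: Balaban1985BackgroundPropagators, (3.25)–(3.27) p.394–395, (3.49) p.399, Thm 3.1 (3.42) p.397, Thm 3.2 (3.48) p.398, (3.19) p.393, (3.90) pp.409–410, (3.106) p.414; Balaban1984PropagatorsII, (2.50)–(2.55) p.232, Lemma 2.1 (2.60)–(2.61) p.234, (2.66)–(2.67) p.234; Balaban1985Averaging, (17)–(20) pp.20–21, (52)–(53) pp.26–27] -/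
theorem hasMajorant_conj_DPDsY_sub_pars_reg335 [Nonempty (Fin N)]
    (hG1 : ∀ u : (Matrix (Fin N) (Fin N) ℂ)ˣ, u ∈ G → ‖(u : Matrix (Fin N) (Fin N) ℂ)‖ ≤ 1) (hGU : G ≤ unitaryUnits (Matrix (Fin N) (Fin N) ℂ))
    {U : CfgY (Matrix (Fin N) (Fin N) ℂ) i} {c₀ α₀ : ℝ} (hc : c₀ ≤ 10) (hMα : 0 ≤ (kGeo i).M * α₀)
    (hreg : (bg9KP (Matrix (Fin N) (Fin N) ℂ) G i).Reg335 c₀ α₀ U) {α₀' : ℝ} (hα' : 0 < α₀') (hα3 : C0 (d + 1) * α₀' ≤ 1 / 3)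
    (hα2 : 2 * α₀' ≤ c2' (d + 1) (ℓ + 1)) (hK : Kpl i ((kGeo i).M * α₀) * (kGeo i).L ^ 4 < α₀')
    (hι : ∀ s, β i.hN i.D i.hk (ιB s) = s)
    (hcf : i.cf = (((ℓ + 1 : ℕ) : ℝ)) ^ i.k)
    {M₂ : ℝ} (hM₂ : 0 ≤ M₂) (hrepr : ∀ (v : Matrix (Fin N) (Fin N) ℂ) (j : ι), |b.repr v j| ≤ M₂ * ‖v‖)
    -- def-Y's-side data at the rate `δ₀`
    {δ₀ A A₁ A₂ K : ℝ} (hA : 0 ≤ A) (hA₁ : 0 ≤ A₁) (hA₂ : 0 ≤ A₂) (hK0 : 0 ≤ K)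
    (hGs : HasMajorant (g := toB6 (geo9K i) Rr Hp) (fun p : SiteY i × ι => ιB (blkOf i.D.toDomains p.1))
      (conj b ((etaS i ^ 2) • (GpY i (parSymY i) U).restrictScalars ℝ)) (fun a a' => A * (geo9K i).len a ^ 2 * Real.exp (-(δ₀ * (geo9K i).dist a a'))))
    (hDl : ∀ μ : Fin (d + 1), HasMajorant (g := toB6 (geo9K i) Rr Hp) (fun p : SiteY i × ι => ιB (blkOf i.D.toDomains p.1))
      (conj b (diffLetter (shiftY i) (UboxY i U) ((|i.cf| : ℝ) : ℂ) (Sum.inl μ)) * conj b ((etaS i ^ 2) • (GpY i (parSymY i) U).restrictScalars ℝ))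
      (fun a a' => A₁ * (geo9K i).len a * Real.exp (-(δ₀ * (geo9K i).dist a a'))))
    (hDr : ∀ ν : Fin (d + 1), HasMajorant (g := toB6 (geo9K i) Rr Hp) (fun p : SiteY i × ι => ιB (blkOf i.D.toDomains p.1))
      (conj b ((etaS i ^ 2) • (GpY i (parSymY i) U).restrictScalars ℝ) * conj b (diffLetter (shiftY i) (UboxY i U) ((|i.cf| : ℝ) : ℂ) (Sum.inr ν)))
      (fun a a' => A₂ * (geo9K i).len a * Real.exp (-(δ₀ * (geo9K i).dist a a'))))
    (hT₀ : HasMajorant (g := toB6 (geo9K i) Rr Hp) (fun q : BlkY i × ι => ιB q.1)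
      (conj b ((etaS i ^ 2 * etaS i ^ 2)⁻¹ • (XinvY i (parSymY i) (GpY i (parSymY i)) U).restrictScalars ℝ))
      (fun a a' => K * ((geo9K i).len a ^ 4)⁻¹ * Real.exp (-(δ₀ * (geo9K i).dist a a'))))
    -- the member's walk geometry; file 9's (2.61)∕(2.63) and window
    (htri : Triangle254 (toB6 (geo9K i) Rr Hp)) (hrefl : ∀ y : (geo9K i).Site, (geo9K i).dist y y = 0)
    (dg : ℕ) {αg : ℝ} (hαδg : 0 ≤ (1 - αg) * δ₀) (hαδg' : 0 ≤ αg * δ₀)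
    (h261g : Ineq261 dg (toB6 (geo9K i) Rr Hp) δ₀ αg) (h263g : Ineq263 dg (toB6 (geo9K i) Rr Hp) δ₀ αg)
    {θE AK : ℝ} (hθE : θE = 32 * ((d : ℝ) + 1) ^ 2 * α₀' * (M₂ * ∑ j, ‖b j‖))
    (hAK : AK = A * B6.c1 dg δ₀ αg * (1 - θE * A * B6.c1 dg δ₀ αg)⁻¹) (hsmallg : θE * A * B6.c1 dg δ₀ αg < 1)
    -- the common rate `δ_c` and the entry differences' Lemma 2.1 (2c-i)
    (db : ℕ) {δc δb αb βb Λ : ℝ} (hΛ : 1 ≤ Λ) (hδc : 0 ≤ δc) (hαb : 0 ≤ αb) (hβb : 0 ≤ βb) (hδb : 0 ≤ δb)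
    (hrb : δc + (αb + βb) * δb ≤ (1 - αg) * δ₀) (h261b : Ineq261 db (toB6 (geo9K i) Rr Hp) δb βb)
    (hT1ib : ScaleTransfer (geo9K i) δb αb Λ (fun a => ((geo9K i).len a)⁻¹))
    -- 5a's ladder for the `C`-letters
    (d₁ d₂ d₃ d₄ : ℕ) {δ δ₁ δ₂ δ₃ αst α' α C C₄ : ℝ} (hδ : δ ≤ (1 - αg) * δ₀)
    (hδ₁ : δ₁ = (1 - α') * ((1 - αst) * δ)) (hδ₂ : δ₂ = (1 - α') * ((1 - αst) * δ₁)) (hδ₃ : δ₃ = (1 - α') * ((1 - αst) * δ₂))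
    (hC : 0 ≤ C) (hC1 : 1 ≤ C) (hC₄ : 0 ≤ C₄) (hαδ : 0 ≤ αst * δ) (hα'0 : 0 ≤ α') (hα'1 : α' ≤ 1) (hδ' : 0 ≤ (1 - αst) * δ)
    (hαδ₂ : 0 ≤ αst * δ₁) (hδ'₂ : 0 ≤ (1 - αst) * δ₁) (hαδ₃ : 0 ≤ αst * δ₂) (hδ'₃ : 0 ≤ (1 - αst) * δ₂) (hα0 : 0 ≤ α) (hαδ₄ : 0 ≤ (1 - α) * δ₃)
    (hST : ScaleTransfer (geo9K i) δ αst C (fun a => (geo9K i).len a ^ 2))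
    (h261 : Ineq261 d₁ (toB6 (geo9K i) Rr Hp) ((1 - αst) * δ) α')
    (hST₂ : ScaleTransfer (geo9K i) δ₁ αst C (fun a => (geo9K i).len a ^ 2))
    (h261₂ : Ineq261 d₂ (toB6 (geo9K i) Rr Hp) ((1 - αst) * δ₁) α')
    (hST₃ : ScaleTransfer (geo9K i) δ₂ αst C₄ (fun a => ((geo9K i).len a ^ 4)⁻¹))
    (h261₃ : Ineq261 d₃ (toB6 (geo9K i) Rr Hp) ((1 - αst) * δ₂) α')
    (h261₄ : Ineq261 d₄ (toB6 (geo9K i) Rr Hp) δ₃ α) (h263₄ : Ineq263 d₄ (toB6 (geo9K i) Rr Hp) δ₃ α)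
    {θF : ℝ} (hθF : θF = (2 * (8 * ((d : ℝ) + 1) ^ 2 * α₀') * (M₂ * ∑ j, ‖b j‖)) * (M₂ * ∑ j, ‖b j‖) * (A * A * C * B6.c1 d₁ ((1 - αst) * δ) α') +
          (M₂ * ∑ j, ‖b j‖) * (M₂ * ∑ j, ‖b j‖) * ((A + AK) * (AK * (θE * A) * C * B6.c1 d₁ ((1 - αst) * δ) α') * C * B6.c1 d₂ ((1 - αst) * δ₁) α') +
          (M₂ * ∑ j, ‖b j‖) * ((2 * (8 * ((d : ℝ) + 1) ^ 2 * α₀') * (M₂ * ∑ j, ‖b j‖))) * (AK * AK * C * B6.c1 d₁ ((1 - αst) * δ) α'))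
    (hsmall : θF * K * C₄ * B6.c1 d₃ ((1 - αst) * δ₂) α' * B6.c1 d₄ δ₃ α < 1)
    {KK : ℝ} (hKK : KK = K * B6.c1 d₄ δ₃ α * (1 - θF * K * C₄ * B6.c1 d₃ ((1 - αst) * δ₂) α' * B6.c1 d₄ δ₃ α)⁻¹)
    (d₅ : ℕ) {δ₅ α₅ β₅ Λ₄ : ℝ} (hΛ₄ : 1 ≤ Λ₄) (hα₅ : 0 ≤ α₅) (hβ₅ : 0 ≤ β₅) (hδ₅ : 0 ≤ δ₅)
    (hr₅ : δc + 2 * (α₅ + β₅) * δ₅ ≤ (1 - α) * δ₃) (h261₅ : Ineq261 d₅ (toB6 (geo9K i) Rr Hp) δ₅ β₅)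
    (hT4₅ : ScaleTransfer (geo9K i) δ₅ α₅ Λ₄ (fun a => ((geo9K i).len a ^ 4)⁻¹))
    -- FILE 2b's own Lemma 2.1
    (dB : ℕ) {δB αB βB ρ ΛB : ℝ} (hΛB : 1 ≤ ΛB) (hρ : 0 ≤ ρ) (hαB : 0 ≤ αB) (hβB : 0 ≤ βB) (hδB : 0 ≤ δB) (hrB : ρ + (2 * αB + βB) * δB ≤ δc)
    (h261B : Ineq261 dB (toB6 (geo9K i) Rr Hp) δB βB) (hT1B : ScaleTransfer (geo9K i) δB αB ΛB (fun a => (geo9K i).len a))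
    (hT4B : ScaleTransfer (geo9K i) δB αB ΛB (fun a => ((geo9K i).len a ^ 4)⁻¹))
    -- the constants
    {κQ θQ BX θX BY θY B₁ θC κJ : ℝ} (hκQ : κQ = M₂ * ∑ j, ‖b j‖) (hθQ : θQ = 2 * (8 * ((d : ℝ) + 1) ^ 2 * α₀') * (M₂ * ∑ j, ‖b j‖))
    (hBX : BX = A₁ * (1 + B6.c1 dg δ₀ αg * (θE * A * B6.c1 dg δ₀ αg * (1 - θE * A * B6.c1 dg δ₀ αg)⁻¹)))
    (hθX : θX = BX * θE * A * Λ * B6.c1 db δb βb) (hBY : BY = ((d : ℝ) + 1) * A₂) (hθY : θY = AK * θE * BY * Λ * B6.c1 db δb βb)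
    (hB₁ : B₁ = max K KK) (hθC : θC = B₁ * B₁ * θF * Λ₄ * B6.c1 d₅ δ₅ β₅ ^ 2)
    (hκJ : κJ = ΛB ^ 4 * B6.c1 dB δB βB ^ 2 *
      (κQ * κQ * θX * B₁ * BY + κQ * θQ * BX * B₁ * BY + κQ * κQ * BX * θC * BY + θQ * κQ * BX * B₁ * BY + κQ * κQ * BX * B₁ * θY)) :
    HasMajorant (g := toB6 (geo9K i) Rr Hp) (fun p : FBondY i × ι => ιB (blkV1 i.hN i.D p.1))
      (conj b ((DPDsY i (parSymY i) (GpY i (parSymY i)) U - DPDsY i (parKnitY i) (GpY i (parKnitY i)) U).restrictScalars ℝ))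
      (fun a a' => κJ * ((geo9K i).len a ^ 2)⁻¹ * Real.exp (-(ρ * (geo9K i).dist a a'))) := by
  have hdnn : ∀ y y' : (geo9K i).Site, 0 ≤ (geo9K i).dist y y' := geo9K_dist_nonneg i
  have hSb : 0 ≤ ∑ j, ‖b j‖ := Finset.sum_nonneg fun _ _ => norm_nonneg _
  have hcg : 0 ≤ B6.c1 dg δ₀ αg := c1_nonneg dg δ₀ αg
  have hcb : 0 ≤ B6.c1 db δb βb := c1_nonneg db δb βb
  -- non-negativity of the named constants
  have hθE0 : 0 ≤ θE := by rw [hθE]; positivity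
  have hinv : 0 ≤ (1 - θE * A * B6.c1 dg δ₀ αg)⁻¹ := inv_nonneg.2 (sub_nonneg.2 hsmallg.le)
  have hAK0 : 0 ≤ AK := by rw [hAK]; exact mul_nonneg (mul_nonneg hA hcg) hinv
  have hc₁ := c1_nonneg d₁ ((1 - αst) * δ) α'
  have hc₂ := c1_nonneg d₂ ((1 - αst) * δ₁) α'
  have hθF0 : 0 ≤ θF := by rw [hθF]; positivity
  have hκQ0 : 0 ≤ κQ := by rw [hκQ]; positivity
  have hθQ0 : 0 ≤ θQ := by rw [hθQ]; positivity
  have hBX0 : 0 ≤ BX := by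
    rw [hBX]; exact mul_nonneg hA₁ (add_nonneg zero_le_one (mul_nonneg hcg (mul_nonneg (mul_nonneg (mul_nonneg hθE0 hA) hcg) hinv)))
  have hθX0 : 0 ≤ θX := by rw [hθX]; positivity
  have hBY0 : 0 ≤ BY := by rw [hBY]; positivity
  have hθY0 : 0 ≤ θY := by rw [hθY]; positivity
  have hB₁0 : 0 ≤ B₁ := by rw [hB₁]; exact hK0.trans (le_max_left _ _)
  have hΛ₄0 : 0 ≤ Λ₄ := zero_le_one.trans hΛ₄
  have hθC0 : 0 ≤ θC := by rw [hθC]; positivity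
  -- the rates `δ_c ≤ (1−α_g)δ₀ ≤ δ₀`
  have hcb0 : 0 ≤ (αb + βb) * δb := by positivity
  have hcg1 : δc ≤ (1 - αg) * δ₀ := by linarith only [hrb, hcb0]
  have hcg0 : δc ≤ δ₀ := by linarith only [hcg1, hαδg']
  -- print's units: `(kGeo i).eta = η`
  have hη : etaS i = (kGeo i).eta := etaS_eq_kGeo_eta_of_cf i hcf
  have hη4 : etaS i ^ 2 * etaS i ^ 2 = (kGeo i).eta ^ 4 := (kGeo_eta_pow_four i hcf).symm
  have hθ : θE * A = 32 * ((d : ℝ) + 1) ^ 2 * α₀' * (M₂ * ∑ j, ‖b j‖) * A := by rw [hθE]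
  have hsmallg' : (32 * ((d : ℝ) + 1) ^ 2 * α₀' * (M₂ * ∑ j, ‖b j‖) * A) * B6.c1 dg δ₀ αg < 1 := by rw [← hθ]; exact hsmallg
  -- §G′: the four entries (p38's 2c-i), at the common rate, in the named constants and print's `η`
  have hX₂ := hasMajorantHom_leftEntry_parKnitY_reg335 i b ιB (Rr := Rr) (Hp := Hp) hG1 hGU hc hMα hreg hα' hα3 hα2 hK hι hcf hM₂ hrepr dg hA hA₁ hαδg hαδg' htri hrefl
    h261g h263g hθ hsmallg ((|i.cf| : ℝ) : ℂ) hGs hDl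
  have hX₂' := hasMajorantHom_rate_mono (R := Rr) (H := Hp) (fun p : SiteY i × ι => ιB (blkOf i.D.toDomains p.1))
    (fun q : (Fin (d + 1) × SiteY i) × ι => ιB (blkOf i.D.toDomains q.1.2)) _ (fun a => (geo9K i).len a) hBX0 (fun a => (geo9K_len_pos i a).le)
    hcg1 hdnn (by rw [hBX]; exact hX₂)
  have hdX := hasMajorantHom_leftEntry_sym_sub_knit_reg335 i b ιB (Rr := Rr) (Hp := Hp) hG1 hGU hc hMα hreg hα' hα3 hα2 hK hι hcf hM₂ hrepr dg hA hA₁ hαδg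
    hαδg' htri hrefl h261g h263g hθ hsmallg ((|i.cf| : ℝ) : ℂ) hGs hDl db hΛ hδc hαb hβb hδb hrb h261b
  rw [← hθE, ← hBX, ← hθX] at hdX
  have hY₁ := hasMajorantHom_rate_mono (R := Rr) (H := Hp) (fun q : (Fin (d + 1) × SiteY i) × ι => ιB (blkOf i.D.toDomains q.1.2))
    (fun p : SiteY i × ι => ιB (blkOf i.D.toDomains p.1)) _ (fun a => (geo9K i).len a) hBY0 (fun a => (geo9K_len_pos i a).le) hcg0 hdnn
    (by rw [hBY]; exact hasMajorantHom_rightEntry_parSymY i b ιB (Rr := Rr) (Hp := Hp) U ((|i.cf| : ℝ) : ℂ) hDr)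
  have hdY := hasMajorantHom_rightEntry_sym_sub_knit_reg335 i b ιB (Rr := Rr) (Hp := Hp) hG1 hGU hc hMα hreg hα' hα3 hα2 hK hι hcf hM₂ hrepr dg hA hA₂ hαδg
    hαδg' htri hrefl h261g h263g hsmallg' ((|i.cf| : ℝ) : ℂ) hGs hDr db (zero_le_one.trans hΛ) hδc hαb hβb hδb hrb h261b hT1ib
  rw [← hθE, ← hAK, ← hBY, ← hθY] at hdY
  rw [hη] at hX₂' hdX hY₁ hdY
  -- §Q′: the block-local letters and their differences (5a §1)
  have hU : ∀ μ x, U μ x ∈ G := fun μ x => mem_of_reg335P (G := G) i hreg μ x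
  have hQ₁ := hasMajorantHom_conjHom_QpY_parSymY i b ιB (Rr := Rr) (Hp := Hp) hGU hU hM₂ hrepr
  have hQ₂ := hasMajorantHom_conjHom_QpY_parKnitY_reg335 i b ιB (Rr := Rr) (Hp := Hp) hG1 hGU hc hMα hreg hα' hα3 hα2 hK hM₂ hrepr
  have hQs₁ := hasMajorantHom_conjHom_QpsY_parSymY i b ιB (Rr := Rr) (Hp := Hp) hGU hU hM₂ hrepr
  have hQs₂ := hasMajorantHom_conjHom_QpsY_parKnitY_reg335 i b ιB (Rr := Rr) (Hp := Hp) hG1 hGU hc hMα hreg hα' hα3 hα2 hK hM₂ hrepr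
  have hdQ := hasMajorantHom_conjHom_QpY_sub_pars_reg335 i b ιB (Rr := Rr) (Hp := Hp) hG1 hGU hc hMα hreg hα' hα3 hα2 hK hM₂ hrepr
  have hdQs := hasMajorantHom_conjHom_QpsY_sub_pars_reg335 i b ιB (Rr := Rr) (Hp := Hp) hG1 hGU hc hMα hreg hα' hα3 hα2 hK hM₂ hrepr
  rw [← hκQ] at hQ₁ hQ₂ hQs₁ hQs₂
  rw [← hθQ] at hdQ hdQs
  -- §C: the three `C`-letters at the common rate (5a §5)
  obtain ⟨hC₁, hC₂, hdC⟩ := cLetters_pars_of_data_reg335 i b ιB (Rr := Rr) (Hp := Hp) hG1 hGU hc hMα hreg hα' hα3 hα2 hK hι hcf hM₂ hrepr dg hA hK0 hαδg hαδg' htri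
    hrefl h261g h263g hθE hAK hsmallg hGs hT₀ d₁ d₂ d₃ d₄ hδ hδ₁ hδ₂ hδ₃ hC hC1 hC₄ hαδ hα'0 hα'1 hδ' hαδ₂ hδ'₂ hαδ₃ hδ'₃ hα0 hαδ₄ hST h261 hST₂ h261₂ hST₃
    h261₃ h261₄ h263₄ hθF hsmall hKK d₅ hΛ₄ hδc hα₅ hβ₅ hδ₅ hr₅ h261₅ hT4₅
  rw [← hB₁] at hC₁ hC₂ hdC
  rw [← hθC, hη4] at hdC
  rw [hη4] at hC₁ hC₂
  -- FILE 2b at `(parSymY, parKnitY)`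
  rw [hκJ]
  exact hasMajorant_conj_DPDsY_sub b i ιB (parSymY i) (parKnitY i) (GpY i (parSymY i)) (GpY i (parKnitY i)) U Rr Hp dB δB δc αB βB ρ ΛB κQ θQ BX θX
    B₁ θC BY θY hκQ0 hθQ0 hBX0 hθX0 hB₁0 hθC0 hBY0 hθY0 hΛB hρ hαB hβB hδB hrB htri h261B hT1B hT4B hX₂' hdX hY₁ hdY hQ₁ hQ₂ hQs₁ hQs₂ hdQ hdQs
    hC₁ hC₂ hdC


end Literature.MathematicalPhysics.QuantumFieldTheory.Balaban1983to89.B9B8KnitBondWordDiffAtParsReg335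

end
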